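import Summits.Ventures.HSemireg.WedgeWeilBlocks
import Summits.Ventures.HSemireg.ContractionRankPointPairBox
import HarnessLib

/-!
# Venture HSemireg — the DECOMPOSABLE («pure») four-term Weil-frame class IS a box for the eigenblock splitting:
# `c₀ + a·w₊ + b·w₋ + c₃·(w₊ ∧ w₋)` with `c₀c₃ = ab` ⟹ `contractionRank = 18` at `n = 2` (the g = 4 anchor) and `6n² - 2n` for `n ≥ 3`

HONEST FRAMING. Pure linear algebra on the carriers of `PerfectComplexRankDoor.lean` (seat p4 of the computation cell `pub-hsemireg`),
closing the «decomposable ⇒ box number» direction of theory/FORMULA-N-th7.md PART B §L.5 (the `n = 2` purity coincidence: the census'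
`18` at `g = 4` is the rank of a DECOMPOSABLE class; th-7: «`v = Σ c_ij ℓ_iℓ′_j` is the class of a box iff `det c = 0`») on the tree's
`contractionRank`: in an ADAPTED WEIL FRAME (`bV : Fin (2n + 2n) → H¹(A)`, first half spanning `H^{0,1}`; carrier Weil vectors `w₊ = wUp bV n`,
`w₋ = wLow bV n` of `WedgeWeilCarrier.lean`, top forms of the two adapted blocks `U₊ = ⟨ℓ_{n+j}, m_j⟩`, `U₋ = ⟨ℓ_j, m_{n+j}⟩`), a class
`c₀·1 + a·w₊ + b·w₋ + c₃·(w₊ ∧ w₋)` with `c₀, c₃, a, b ≠ 0` and the PURITY relation `c₀c₃ = ab` (`det [[c₀, b], [a, c₃]] = 0`) is LITERALLY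
the box `(1 + (a/c₀)·ω₊) ∧ (c₀ + b·ω₋)` of two point-type factors on the complementary blocks `U₊ ⊕ U₋ = H¹(A)`, so p4 gen 2's
`contractionRank_pointPairBox_two` / `contractionRank_pointPairBox` apply: `r = 18` (`n = 2`) and `r = 6n² - 2n` (`n ≥ 3`; there the purity
relation is NOT needed — `ContractionRankWeil.contractionRank_weil_fourTerm`).  The converse at `n = 2` («`r = 18` forces purity; generic `20`»,
§L.5) is NOT proved here.  The frame and the class identity are BY-VALUE hypotheses exactly as in `ContractionRankWeil.lean`; nothing here is a
claim about any explicit variety; nothing here says that HC / HC_CM / HC_AV holds.  Everything PROVED; no named fact.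
References: [BourbakiAlgebre1a3] Ch. III §7; [BuchweitzFlenner2008HH] Prop. 6.4.4 (why these operators).
-/

noncomputable section

open Module
open Literature.AlgebraicGeometry.Motives Literature.AlgebraicGeometry.HodgeTheory

namespace Summit.Ventures.HSemireg

namespace WeilCarrier

open Summit.Ventures.HSemireg.WedgeBridge
open ExteriorAlgebra (ι)

variable {K : Type*} [Field K] {n : ℕ} {V : Type*} [AddCommGroup V] [Module K V]
  (bV : Basis (Fin (n + n + (n + n))) K V)

/-! ### 3. The pure four-term class IS the box -/

/-- **PURITY ⇒ BOX:** with `c₀ ≠ 0` and `c₀c₃ = ab`,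
`c₀·1 + a·w₊ + b·w₋ + c₃·(w₊ ∧ w₋) = Λ(ι_{U₊})(1 + (a/c₀)·ω₊) ∧ Λ(ι_{U₋})(c₀ + b·ω₋)`.
[cite: BourbakiAlgebre1a3, Ch. III §7 no. 1] -/
theorem fourTerm_eq_box {c₀ c₃ a b : K} (hc₀ : c₀ ≠ 0) (hpure : c₀ * c₃ = a * b) :
    algebraMap K _ c₀ + a • wUp bV n + b • wLow bV n + c₃ • (wUp bV n * wLow bV n) =
      ExteriorAlgebra.map (Uup n bV).subtype (algebraMap K _ 1 + (a * c₀⁻¹) • omegaUp bV) *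
        ExteriorAlgebra.map (Ulow n bV).subtype (algebraMap K _ c₀ + b • omegaLow bV) := by
  have hc₃ : c₃ = a * c₀⁻¹ * b := by
    field_simp
    linear_combination hpure
  rw [map_add, map_add, map_smul, map_smul, AlgHom.commutes, AlgHom.commutes, map_omegaUp, map_omegaLow, map_one,
    Algebra.algebraMap_eq_smul_one, add_mul, mul_add, mul_add, one_mul, one_mul, smul_mul_assoc, smul_mul_assoc,
    mul_smul_comm, mul_smul_comm, mul_one, smul_smul, smul_smul, hc₃]
  rw [show a * c₀⁻¹ * c₀ = a by rw [mul_assoc, inv_mul_cancel₀ hc₀, mul_one]]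
  abel

end WeilCarrier

/-! ### 4. The door: `r = 18` at the `g = 4` anchor for a PURE Weil-frame class; `6n² - 2n` for `n ≥ 3` -/

variable {A : AbelianVariety ℂ}

/-- **`r(A, κ) = 18` for a PURE (decomposable) four-term Weil-frame class on an abelian FOURFOLD** (`n = 2`): with an adapted basis `bV`
of `H¹(A)` (first half spanning `H^{0,1}`), `totalExteriorClass A κ = c₀·1 + a·w₊ + b·w₋ + c₃·(w₊ ∧ w₋)`, `c₀, a, b ≠ 0` (hence `c₃ ≠ 0`) and
`c₀c₃ = ab` ⟹ `contractionRank A κ = 18` — p4 gen 2's `contractionRank_pointPairBox_two` for the eigenblock splitting `H¹ = U₊ ⊕ U₋`.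
[cite: BuchweitzFlenner2008HH, Prop. 6.4.4] [cite: MumfordAV1970, §1 (4) and §4 (iii)] -/
theorem contractionRank_weil_pure_two (hA : IsSmoothProjective A.dim A.X) (κ : ∀ p : ℕ, complexBetti A.X (2 * p))
    (bV : Basis (Fin (2 + 2 + (2 + 2))) ℂ (complexBetti A.X 1)) (hL : hodgeZeroOne hA = WedgeBridge.Lsp bV)
    {c₀ c₃ a b : ℂ} (hc₀ : c₀ ≠ 0) (ha : a ≠ 0) (hb : b ≠ 0) (hpure : c₀ * c₃ = a * b)
    (hx : totalExteriorClass A κ =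
      algebraMap ℂ _ c₀ + a • WeilCarrier.wUp bV 2 + b • WeilCarrier.wLow bV 2 +
        c₃ • (WeilCarrier.wUp bV 2 * WeilCarrier.wLow bV 2)) :
    contractionRank A κ = 18 := by
  rw [WeilCarrier.fourTerm_eq_box bV hc₀ hpure] at hx
  have hL' : hodgeZeroOne hA = WeilCarrier.Lup 2 bV ⊔ WeilCarrier.Llow 2 bV := by rw [hL, WeilCarrier.Lsp_eq_sup]
  exact contractionRank_pointPairBox_two hA κ (WeilCarrier.isCompl_Uup_Ulow bV) (WeilCarrier.finrank_Uup bV)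
    (WeilCarrier.finrank_Ulow bV) hL' (WeilCarrier.Lup_le_Uup bV) (WeilCarrier.Llow_le_Ulow bV) (WeilCarrier.finrank_Lup bV)
    (WeilCarrier.finrank_Llow bV) (WeilCarrier.omegaUp_mem bV) (WeilCarrier.omegaUp_ne_zero bV) (WeilCarrier.omegaLow_mem bV)
    (WeilCarrier.omegaLow_ne_zero bV) one_ne_zero (mul_ne_zero ha (inv_ne_zero hc₀)) hc₀ hb hx

/-- **`r(A, κ) = 6n² - 2n` for a pure four-term Weil-frame class, `n ≥ 3`** (the same route; here the purity relation is not needed for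
the NUMBER — `contractionRank_weil_fourTerm` — but it is what makes the class a literal box).
[cite: BuchweitzFlenner2008HH, Prop. 6.4.4] [cite: MumfordAV1970, §1 (4) and §4 (iii)] -/
theorem contractionRank_weil_pure (hA : IsSmoothProjective A.dim A.X) (κ : ∀ p : ℕ, complexBetti A.X (2 * p)) {n : ℕ}
    (hn : 3 ≤ n) (bV : Basis (Fin (n + n + (n + n))) ℂ (complexBetti A.X 1)) (hL : hodgeZeroOne hA = WedgeBridge.Lsp bV)
    {c₀ c₃ a b : ℂ} (hc₀ : c₀ ≠ 0) (ha : a ≠ 0) (hb : b ≠ 0) (hpure : c₀ * c₃ = a * b)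
    (hx : totalExteriorClass A κ =
      algebraMap ℂ _ c₀ + a • WeilCarrier.wUp bV n + b • WeilCarrier.wLow bV n +
        c₃ • (WeilCarrier.wUp bV n * WeilCarrier.wLow bV n)) :
    contractionRank A κ = ((6 * n ^ 2 - 2 * n : ℕ) : Cardinal) := by
  rw [WeilCarrier.fourTerm_eq_box bV hc₀ hpure] at hx
  have hL' : hodgeZeroOne hA = WeilCarrier.Lup n bV ⊔ WeilCarrier.Llow n bV := by rw [hL, WeilCarrier.Lsp_eq_sup]
  have h2n : Module.finrank ℂ (WeilCarrier.Uup n bV) = 2 * n := by rw [WeilCarrier.finrank_Uup, two_mul]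
  have h2n' : Module.finrank ℂ (WeilCarrier.Ulow n bV) = 2 * n := by rw [WeilCarrier.finrank_Ulow, two_mul]
  have hω₁ : WeilCarrier.omegaUp bV ∈ ⋀[ℂ]^(2 * n) (WeilCarrier.Uup n bV) := by
    rw [two_mul]; exact WeilCarrier.omegaUp_mem bV
  have hω₂ : WeilCarrier.omegaLow bV ∈ ⋀[ℂ]^(2 * n) (WeilCarrier.Ulow n bV) := by
    rw [two_mul]; exact WeilCarrier.omegaLow_mem bV
  exact contractionRank_pointPairBox hA κ hn (WeilCarrier.isCompl_Uup_Ulow bV) h2n h2n' hL' (WeilCarrier.Lup_le_Uup bV)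
    (WeilCarrier.Llow_le_Ulow bV) (WeilCarrier.finrank_Lup bV) (WeilCarrier.finrank_Llow bV) hω₁
    (WeilCarrier.omegaUp_ne_zero bV) hω₂ (WeilCarrier.omegaLow_ne_zero bV) one_ne_zero
    (mul_ne_zero ha (inv_ne_zero hc₀)) hc₀ hb hx

end Summit.Ventures.HSemireg

end
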